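import Summits.PneNP.PneNP.Theorems.ChebyshevTracialDesignPseudoMatchingBaseOneCounts

/-!
# Cell pnp-psdrank, route `ChebyshevTracialDesign`: the THRESHOLD CERTIFICATE `(|W|, k) = (5, 1)` of the pseudo-matching form, and
# matching-side low-degree pricing at matching-degree `1` UNCONDITIONALLY (crux `TracialDecayExp20`, stmt-PneNP-19878; eng g14, MEMO-14 §2)

The base case that `…PseudoMatchingFormRecursion.form_nonneg_of_base` (p561862) asks for at `k = 1`: for every `W ⊆ [n]` with `|W| = 5` and every
`δ` on `{A : |A| ≤ 1}`, `0 ≤ Σ_{A,A'} δ_A δ_{A'} ν_W(A ∪ A')`, where `ν_W(G) = [G extends to a perfect matching of K_n, G ⊆ E(W)]·∏_{j<|G|}(|W|−1−2j)⁻¹`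
is Potechin's story pseudo-moment [cite: Potechin2019, Example 3.4 and Thm. 1.2 (LIPIcs 124, 61:7, 61:4)].
* §1 the moments of `≤ 2`-edge sets inside a `5`-set: `nu_empty` (= 1), `nu_single` (= 1/4 on clique edges), `nu_eq_zero_of_not_mem` (loops and
  edges leaving `W` kill everything), **`nu_pair`**: `8·ν_W({e} ∪ {f}) = 1 + 3[e = f] − #(common ends)` (1/4, 1/8 disjoint, 0 adjacent).
* §2 **`form_nonneg_base_one`** — the certificate: off the clique edge set all terms vanish; on `∅` and the ten edges the form equals
  `c₀² + c₀S/2 + (S² + 3|c|² − Σ_x m_x²)/8 = (c₀ + S/4)² + (1/96)Σ_e (6c_e + S − 2Σ_{x∈e} m_x)²` (`…BaseOneCounts.quad_nonneg_of_clique_counts`).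
  Exact cross-check (kit j288815, eng g14): the live `11 × 11` matrix has spectrum `{13/8, 3/8 (×5), 0 (×5)}`.
* §3 **`sum_levelWeight_trace_nonpos_of_lowDegreeM_one`** — hence, with NO hypothesis beyond the design: `n` even, an exact design of degree
  `D ≥ 2` on the `t`-cuts, `5 ≤ t`, `5 ≤ n − t`, `X` an ARBITRARY psd cut family, `B` of matching-degree `≤ 1` (`IsLowDegreeM n 1 B`, e.g. the
  edge-additive pure states) ⇒ `Σ_U Σ_M levelWeight(U,M)·tr(X_U B_M B_Mᵀ) ≤ 0`.
Stature: support/instrument (kernel-checked finite algebra; no definitions; axioms standard; closes the `k = 1` row of matching-side low-degree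
pricing without any Literature fact — independent of the disputed Lemma 5.13 of the printed proof of Potechin's Thm. 1.2). WHAT THIS IS NOT: not the
`k ≥ 2` certificates (eng g14 MEMO-14: `(9,2)` certified exactly off-kernel, spectrum `{221/128, 89/384 (×27), 5/128 (×42), 1/32 (×120), 0 (×225)}`),
nothing on the dense cell, nothing on psd rank, no P-vs-NP content. Supports stmt-PneNP-19878.
-/

set_option linter.dupNamespace false -- `Summit.PneNP.PneNP.…`: summit = sub-problem (D-0017)

noncomputable section

namespace Summit.PneNP.PneNP.Theorems.ChebyshevTracialDesignPseudoMatchingBaseOne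

open Finset Matrix Literature.Barriers.PneNP Literature.Combinatorics.Optimization
open Summit.PneNP.PneNP.Theorems.ChebyshevTracialDesignJunta
open Summit.PneNP.PneNP.Theorems.ChebyshevTracialDesignPseudoMatchingFormRecursion
open scoped MatrixOrder

variable {n : ℕ}

/-! ### §1 The pseudo-matching moments of `≤ 2`-edge sets inside a `5`-set -/

/-- The moment of the empty set is `1` (when a perfect matching exists). [folklore] -/
theorem nu_empty (ν : Finset (Fin n) → Finset (Sym2 (Fin n)) → ℝ)
    (hν : ∀ W G, ν W G = if ((univ : Finset (PMatch n)).filter fun M => G ⊆ M.1).Nonempty ∧ (∀ e ∈ G, ∀ x ∈ e, x ∈ W) then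
      (∏ j ∈ range G.card, ((W.card : ℝ) - 1 - 2 * j))⁻¹ else 0)
    (hn : Even n) (W : Finset (Fin n)) : ν W ∅ = 1 := by
  rw [hν, if_pos ⟨by simpa using extends_of_isPMOn hn IsPMOn.empty, by simp⟩]
  simp

/-- The moment of a clique edge of a `5`-clique is `1/4`. [folklore] -/
theorem nu_single (ν : Finset (Fin n) → Finset (Sym2 (Fin n)) → ℝ)
    (hν : ∀ W G, ν W G = if ((univ : Finset (PMatch n)).filter fun M => G ⊆ M.1).Nonempty ∧ (∀ e ∈ G, ∀ x ∈ e, x ∈ W) then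
      (∏ j ∈ range G.card, ((W.card : ℝ) - 1 - 2 * j))⁻¹ else 0)
    (hn : Even n) {W : Finset (Fin n)} (hW : W.card = 5) {e : Sym2 (Fin n)}
    (he : e ∈ W.offDiag.image (Function.uncurry Sym2.mk)) : ν W {e} = 1 / 4 := by
  obtain ⟨⟨a, b⟩, hp, rfl⟩ := mem_image.1 he
  obtain ⟨ha, hb, hab⟩ := mem_offDiag.1 hp
  simp only [Function.uncurry_apply_pair]
  have hext := extends_of_isPMOn hn (IsPMOn.pair hab)
  have hin : ∀ e ∈ ({s(a, b)} : Finset (Sym2 (Fin n))), ∀ x ∈ e, x ∈ W := by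
    intro e he x hx
    rw [mem_singleton] at he; subst he
    rcases Sym2.mem_iff.1 hx with rfl | rfl
    · exact ha
    · exact hb
  rw [hν, if_pos ⟨hext, hin⟩, card_singleton, hW]
  norm_num

/-- Off the clique edge set the moments vanish: a loop or an edge leaving `W` kills every set containing it. [folklore] -/
theorem nu_eq_zero_of_not_mem (ν : Finset (Fin n) → Finset (Sym2 (Fin n)) → ℝ)
    (hν : ∀ W G, ν W G = if ((univ : Finset (PMatch n)).filter fun M => G ⊆ M.1).Nonempty ∧ (∀ e ∈ G, ∀ x ∈ e, x ∈ W) then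
      (∏ j ∈ range G.card, ((W.card : ℝ) - 1 - 2 * j))⁻¹ else 0)
    {W : Finset (Fin n)} {e : Sym2 (Fin n)} (he : e ∉ W.offDiag.image (Function.uncurry Sym2.mk))
    {G : Finset (Sym2 (Fin n))} (heG : e ∈ G) : ν W G = 0 := by
  rw [hν, if_neg]
  rintro ⟨⟨M, hM⟩, hW⟩
  apply he
  rw [mem_cliqueEdges]
  exact ⟨hW e heG, M.2.not_isDiag ((mem_filter.1 hM).2 heG)⟩

/-- The pair moments on the clique edge set of a `5`-set: `8·ν_W({e} ∪ {f}) = 1 + 3[e = f] − #(common ends)`, i.e. `1/4` on the diagonal,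
`1/8` for disjoint edges and `0` for two edges with a common end. [folklore] -/
theorem nu_pair (ν : Finset (Fin n) → Finset (Sym2 (Fin n)) → ℝ)
    (hν : ∀ W G, ν W G = if ((univ : Finset (PMatch n)).filter fun M => G ⊆ M.1).Nonempty ∧ (∀ e ∈ G, ∀ x ∈ e, x ∈ W) then
      (∏ j ∈ range G.card, ((W.card : ℝ) - 1 - 2 * j))⁻¹ else 0)
    (hn : Even n) {W : Finset (Fin n)} (hW : W.card = 5) {e f : Sym2 (Fin n)}
    (he : e ∈ W.offDiag.image (Function.uncurry Sym2.mk)) (hf : f ∈ W.offDiag.image (Function.uncurry Sym2.mk)) :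
    8 * ν W ({e} ∪ {f}) = 1 + 3 * (if e = f then 1 else 0) - ((W.filter fun x => x ∈ e ∧ x ∈ f).card : ℝ) := by
  classical
  by_cases hef : e = f
  · subst hef
    rw [if_pos rfl, union_idempotent, nu_single ν hν hn hW he]
    have : (W.filter fun x => x ∈ e ∧ x ∈ e) = W.filter fun x => x ∈ e := by ext x; simp
    rw [this, card_ends_eq_two he]
    norm_num
  rw [if_neg hef]
  obtain ⟨⟨a, b⟩, hp, rfl⟩ := mem_image.1 he
  obtain ⟨⟨c, d⟩, hq, rfl⟩ := mem_image.1 hf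
  obtain ⟨ha, hb, hab⟩ := mem_offDiag.1 hp
  obtain ⟨hc, hd, hcd⟩ := mem_offDiag.1 hq
  simp only [Function.uncurry_apply_pair] at hef ⊢
  by_cases hcommon : ∃ x, x ∈ s(a, b) ∧ x ∈ s(c, d)
  · -- a common end: moment `0`, exactly one common end
    obtain ⟨x, hxe, hxf⟩ := hcommon
    have h0 : ν W ({s(a, b)} ∪ {s(c, d)}) = 0 := by
      rw [hν, if_neg]
      rintro ⟨hne, -⟩
      exact not_extends_of_common_end hef hxe hxf hne
    have h1 : (W.filter fun y => y ∈ s(a, b) ∧ y ∈ s(c, d)).card = 1 := by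
      apply le_antisymm (card_common_ends_le_one he hef)
      rw [Nat.one_le_iff_ne_zero, ← pos_iff_ne_zero, card_pos]
      refine ⟨x, mem_filter.2 ⟨?_, hxe, hxf⟩⟩
      rcases Sym2.mem_iff.1 hxe with rfl | rfl
      · exact ha
      · exact hb
    rw [h0, h1]; norm_num
  · -- disjoint edges: a `2`-matching, moment `1/(4·2)`
    push Not at hcommon
    have h0 : (W.filter fun y => y ∈ s(a, b) ∧ y ∈ s(c, d)).card = 0 := by
      rw [card_eq_zero, filter_eq_empty_iff]
      intro y _ h
      exact hcommon y h.1 h.2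
    have hac : a ≠ c := fun h => hcommon a (Sym2.mem_mk_left _ _) (h ▸ Sym2.mem_mk_left _ _)
    have had : a ≠ d := fun h => hcommon a (Sym2.mem_mk_left _ _) (h ▸ Sym2.mem_mk_right _ _)
    have hbc : b ≠ c := fun h => hcommon b (Sym2.mem_mk_right _ _) (h ▸ Sym2.mem_mk_left _ _)
    have hbd : b ≠ d := fun h => hcommon b (Sym2.mem_mk_right _ _) (h ▸ Sym2.mem_mk_right _ _)
    have hdisj : Disjoint ({a, b} : Finset (Fin n)) {c, d} := by
      rw [disjoint_left]; intro y hy hy'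
      simp only [mem_insert, mem_singleton] at hy hy'
      rcases hy with rfl | rfl <;> rcases hy' with h | h
      · exact hac h
      · exact had h
      · exact hbc h
      · exact hbd h
    have hPM : IsPMOn (({a, b} : Finset (Fin n)) ∪ {c, d}) ({s(a, b)} ∪ {s(c, d)}) :=
      (IsPMOn.pair hab).union (IsPMOn.pair hcd) hdisj
    have hext := extends_of_isPMOn hn hPM
    have hcard : (({s(a, b)} ∪ {s(c, d)}) : Finset (Sym2 (Fin n))).card = 2 := by
      rw [← insert_eq, card_insert_of_notMem (by rwa [mem_singleton]), card_singleton]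
    have hin : ∀ g ∈ (({s(a, b)} ∪ {s(c, d)}) : Finset (Sym2 (Fin n))), ∀ y ∈ g, y ∈ W := by
      intro g hg y hy
      simp only [mem_union, mem_singleton] at hg
      rcases hg with rfl | rfl
      · rcases Sym2.mem_iff.1 hy with rfl | rfl
        · exact ha
        · exact hb
      · rcases Sym2.mem_iff.1 hy with rfl | rfl
        · exact hc
        · exact hd
    rw [h0, hν, if_pos ⟨hext, hin⟩, hcard, hW]
    norm_num [prod_range_succ]
/-! ### §2 The base certificate at `(|W|, k) = (5, 1)` -/

/-- **BASE CERTIFICATE `(5, 1)`.** For every `W ⊆ [n]` with `|W| = 5` the pseudo-matching form `δ ↦ Σ_{A,A'} δ_A δ_{A'} ν_W(A ∪ A')` is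
nonnegative on coefficient vectors indexed by `{A : |A| ≤ 1}`. Proof: the live indices are `∅` and the ten clique edges of `W`; on them the
form is `c₀² + c₀S/2 + (S² + 3|c|² − Σ_x m_x²)/8` (`S = Σ_e c_e`, `m_x = Σ_{e ∋ x} c_e`), which is
`(c₀ + S/4)² + (1/96)·Σ_e (6c_e + S − 2Σ_{x∈e} m_x)²` (the Petersen graph `KG(5,2)` has least eigenvalue `−2`). Exact check: the
`11 × 11` matrix has spectrum `{13/8, 3/8 (×5), 0 (×5)}` (kit j288815). [cite: Potechin2019, Thm. 1.2 at (m, d) = (5, 1) (LIPIcs 124, 61:4)] -/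
theorem form_nonneg_base_one (ν : Finset (Fin n) → Finset (Sym2 (Fin n)) → ℝ)
    (hν : ∀ W G, ν W G = if ((univ : Finset (PMatch n)).filter fun M => G ⊆ M.1).Nonempty ∧ (∀ e ∈ G, ∀ x ∈ e, x ∈ W) then
      (∏ j ∈ range G.card, ((W.card : ℝ) - 1 - 2 * j))⁻¹ else 0)
    {W : Finset (Fin n)} (hW : W.card = 5) (δ : {A : Finset (Sym2 (Fin n)) // A.card ≤ 1} → ℝ) :
    0 ≤ ∑ A, ∑ A', δ A * δ A' * ν W (A.1 ∪ A'.1) := by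
  classical
  by_cases hPM : Nonempty (PMatch n)
  swap
  · -- no perfect matching at all: `ν ≡ 0`
    have h0 : ∀ G, ν W G = 0 := fun G => by
      rw [hν, if_neg]
      rintro ⟨⟨M, -⟩, -⟩
      exact hPM ⟨M⟩
    simp [h0]
  obtain ⟨M₀⟩ := hPM
  have hn : Even n := even_of_pmatch M₀
  set EW := W.offDiag.image (Function.uncurry Sym2.mk) with hEW
  set c₀ : ℝ := δ ⟨∅, by simp⟩ with hc₀
  set c : Sym2 (Fin n) → ℝ := fun e => δ ⟨{e}, by simp⟩ with hc
  -- Step 1: expand the two sums over `{A : |A| ≤ 1}`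
  have hexp : ∑ A, ∑ A', δ A * δ A' * ν W (A.1 ∪ A'.1) =
      c₀ * c₀ * ν W ∅ + ∑ f, c₀ * c f * ν W {f} + ∑ e, (c e * c₀ * ν W {e} + ∑ f, c e * c f * ν W ({e} ∪ {f})) := by
    simp only [sum_card_le_one, empty_union, union_empty]
    rfl
  -- Step 2: kill the indices off the clique edge set
  have hkill : ∀ e ∉ EW, ∀ G : Finset (Sym2 (Fin n)), e ∈ G → ν W G = 0 :=
    fun e he G heG => nu_eq_zero_of_not_mem ν hν he heG
  have h1 : ∑ f, c₀ * c f * ν W {f} = ∑ f ∈ EW, c₀ * c f * (1 / 4) := by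
    rw [← sum_subset (subset_univ EW) (fun f _ hf => by rw [hkill f hf {f} (mem_singleton_self f), mul_zero])]
    exact sum_congr rfl fun f hf => by rw [nu_single ν hν hn hW hf]
  have h2 : ∑ e, (c e * c₀ * ν W {e} + ∑ f, c e * c f * ν W ({e} ∪ {f})) =
      ∑ e ∈ EW, (c e * c₀ * (1 / 4) + ∑ f ∈ EW, c e * c f * ν W ({e} ∪ {f})) := by
    rw [← sum_subset (subset_univ EW) (fun e _ he => by
      rw [hkill e he {e} (mem_singleton_self e), mul_zero, zero_add]
      exact sum_eq_zero fun f _ => by rw [hkill e he ({e} ∪ {f}) (by simp), mul_zero])]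
    refine sum_congr rfl fun e he => ?_
    rw [nu_single ν hν hn hW he,
      ← sum_subset (subset_univ EW) (fun f _ hf => by rw [hkill f hf ({e} ∪ {f}) (by simp), mul_zero])]
  -- Step 3: the pair moments
  have h3 : ∀ e ∈ EW, ∑ f ∈ EW, c e * c f * ν W ({e} ∪ {f}) =
      ∑ f ∈ EW, c e * c f * ((1 + 3 * (if e = f then 1 else 0) - ((W.filter fun x => x ∈ e ∧ x ∈ f).card : ℝ)) / 8) := by
    intro e he
    refine sum_congr rfl fun f hf => ?_
    rw [← nu_pair ν hν hn hW he hf]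
    ring
  have h2' : ∑ e ∈ EW, (c e * c₀ * (1 / 4) + ∑ f ∈ EW, c e * c f * ν W ({e} ∪ {f})) =
      ∑ e ∈ EW, (c e * c₀ * (1 / 4) + ∑ f ∈ EW, c e * c f *
        ((1 + 3 * (if e = f then 1 else 0) - ((W.filter fun x => x ∈ e ∧ x ∈ f).card : ℝ)) / 8)) :=
    sum_congr rfl fun e he => by rw [h3 e he]
  rw [hexp, nu_empty ν hν hn W, h1, h2, h2']
  -- Step 4: collect into the closed form of §1
  have hT : ∀ e ∈ EW, ∀ f ∈ EW, ((W.filter fun x => x ∈ e ∧ x ∈ f).card : ℝ) = ∑ x ∈ W, if x ∈ e ∧ x ∈ f then 1 else 0 := by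
    intro e _ f _
    rw [← sum_filter]
    simp
  have hquad : ∑ e ∈ EW, ∑ f ∈ EW, c e * c f * ((W.filter fun x => x ∈ e ∧ x ∈ f).card : ℝ) =
      ∑ x ∈ W, (∑ e ∈ EW.filter (fun e => x ∈ e), c e) ^ 2 := by
    rw [sum_congr rfl fun e he => sum_congr rfl fun f hf => by rw [hT e he f hf, mul_sum]]
    have hx : ∀ x ∈ W, (∑ e ∈ EW.filter (fun e => x ∈ e), c e) ^ 2 =
        ∑ e ∈ EW, ∑ f ∈ EW, c e * c f * (if x ∈ e ∧ x ∈ f then 1 else 0) := by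
      intro x _
      rw [sq, sum_filter, sum_mul_sum]
      refine sum_congr rfl fun e _ => sum_congr rfl fun f _ => ?_
      by_cases h1 : x ∈ e <;> by_cases h2 : x ∈ f <;> simp [h1, h2]
    rw [sum_congr rfl fun e _ => sum_comm, sum_comm]
    exact (sum_congr rfl hx).symm
  have hS2 : ∑ e ∈ EW, ∑ f ∈ EW, c e * c f = (∑ e ∈ EW, c e) ^ 2 := by rw [sq, sum_mul_sum]
  have hdiag : ∑ e ∈ EW, ∑ f ∈ EW, c e * c f * (if e = f then 1 else 0) = ∑ e ∈ EW, c e ^ 2 := by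
    refine sum_congr rfl fun e he => ?_
    simp only [mul_ite, mul_one, mul_zero]
    rw [sum_ite_eq EW e, if_pos he, sq]
  have hclosed : c₀ * c₀ * 1 + ∑ f ∈ EW, c₀ * c f * (1 / 4) +
      ∑ e ∈ EW, (c e * c₀ * (1 / 4) + ∑ f ∈ EW, c e * c f *
        ((1 + 3 * (if e = f then 1 else 0) - ((W.filter fun x => x ∈ e ∧ x ∈ f).card : ℝ)) / 8)) =
      c₀ ^ 2 + c₀ * (∑ e ∈ EW, c e) / 2 +
      ((∑ e ∈ EW, c e) ^ 2 + 3 * ∑ e ∈ EW, c e ^ 2 - ∑ x ∈ W, (∑ e ∈ EW.filter (fun e => x ∈ e), c e) ^ 2) / 8 := by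
    rw [← hquad, ← hdiag, ← hS2]
    have hinner : ∀ e ∈ EW, (c e * c₀ * (1 / 4) + ∑ f ∈ EW, c e * c f *
        ((1 + 3 * (if e = f then 1 else 0) - ((W.filter fun x => x ∈ e ∧ x ∈ f).card : ℝ)) / 8)) =
        c₀ / 4 * c e + ((1 / 8) * ∑ f ∈ EW, c e * c f + (3 / 8) * ∑ f ∈ EW, c e * c f * (if e = f then 1 else 0) -
          (1 / 8) * ∑ f ∈ EW, c e * c f * ((W.filter fun x => x ∈ e ∧ x ∈ f).card : ℝ)) := by
      intro e _
      rw [mul_sum, mul_sum, mul_sum, ← sum_add_distrib, ← sum_sub_distrib]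
      congr 1
      · ring
      · exact sum_congr rfl fun f _ => by ring
    have hfirst : ∑ f ∈ EW, c₀ * c f * (1 / 4) = c₀ / 4 * ∑ f ∈ EW, c f := by
      rw [mul_sum]; exact sum_congr rfl fun f _ => by ring
    rw [sum_congr rfl hinner, hfirst]
    simp only [sum_add_distrib, sum_sub_distrib, ← mul_sum]
    ring
  rw [hclosed]
  -- Step 5: the incidence counts of `K_5` and §1
  refine quad_nonneg_of_clique_counts EW W (fun x e => x ∈ e) (fun e he => card_ends_eq_two he)
    (fun x hx => by rw [card_edges_at hx, hW]) (fun x hx y hy hxy => card_edges_at_pair hx hy hxy) ?_ c₀ c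
  rw [hEW, card_cliqueEdges, hW]
  decide

/-! ### §3 Unconditional matching-side pricing at matching-degree `1` -/

/-- **MATCHING-SIDE LOW-DEGREE PRICING, `k = 1`, UNCONDITIONAL.** Let `n` be even, `(C, w)` an exact design of degree `D ≥ 2` on the `t`-cuts
with `5 ≤ t` and `5 ≤ n − t`, `X` an ARBITRARY psd cut family and `B` a matching-side Gram family of matching-degree `≤ 1`
(`IsLowDegreeM n 1 B`: entries in `span{1, 1[e ∈ M]}` — this contains the edge-additive pure states). Then
`Σ_U Σ_M levelWeight(U,M)·tr(X_U B_M B_Mᵀ) ≤ 0`. The threshold certificate of `…_of_base` is `form_nonneg_base_one`; no named fact is used.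
[cite: Potechin2019, Thm. 1.2 (LIPIcs 124, 61:4)] [cite: Rothvoss2017, §2 (PDF p. 6)] -/
theorem sum_levelWeight_trace_nonpos_of_lowDegreeM_one (hn : Even n) {t T D : ℕ} {Bv : ℝ} {C : Finset ℕ} {w : ℕ → ℝ}
    (hdes : IsExactDesign n t T D Bv C w) {r m : ℕ} (hD : 2 ≤ D) (ht : 5 ≤ t) (hnt : 5 ≤ n - t)
    (X : OddSet n → Matrix (Fin r) (Fin r) ℝ) (hX : ∀ U, (X U).PosSemidef)
    (B : PMatch n → Matrix (Fin r) (Fin m) ℝ) (hB : IsLowDegreeM n 1 B) :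
    ∑ U, ∑ M, levelWeight n t C w U M * (X U * (B M * (B M)ᵀ)).trace ≤ 0 := by
  set ν : Finset (Fin n) → Finset (Sym2 (Fin n)) → ℝ := fun W G =>
    if ((univ : Finset (PMatch n)).filter fun M => G ⊆ M.1).Nonempty ∧ (∀ e ∈ G, ∀ x ∈ e, x ∈ W) then
      (∏ j ∈ range G.card, ((W.card : ℝ) - 1 - 2 * j))⁻¹ else 0 with hνdef
  have hν : ∀ W G, ν W G = if ((univ : Finset (PMatch n)).filter fun M => G ⊆ M.1).Nonempty ∧ (∀ e ∈ G, ∀ x ∈ e, x ∈ W) then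
      (∏ j ∈ range G.card, ((W.card : ℝ) - 1 - 2 * j))⁻¹ else 0 := fun W G => rfl
  exact sum_levelWeight_trace_nonpos_of_lowDegreeM_of_base hn hdes (k := 1) (by omega) (by omega) (by omega) X hX B hB ν hν
    (fun W hW δ => form_nonneg_base_one ν hν hW δ)

end Summit.PneNP.PneNP.Theorems.ChebyshevTracialDesignPseudoMatchingBaseOne
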